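import Summits.QuantumFields.BalabanUV.Beta.GAN24.StripAliasBounds
import Summits.QuantumFields.BalabanUV.Beta.GAN24.CapacitanceScalarDictionary

/-!
# `BalabanUV.Beta.GAN24.StripAliasGoodBlocks` — binder row G-an2-4 / (CONV-C), road P1-fibre, self-row **Y10g\*** part 2 (input of p1's
# leaf L10 `FibreStrip`, nodes N15k/N15u): THE GOOD ALIASES `m ≠ 0` STAY REGULAR ON THE STRIP, UNIFORMLY IN `N`

NOT IN PRINT; OUR PROOF ATTEMPT.  HONEST FRAMING (cell contract, verbatim): «discharging `BetaPertH` makes Bałaban's UV stability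
UNCONDITIONAL — a real constructive-QFT result; it is NOT the continuum limit and NOT the Clay problem.»  HONEST DEPENDENCY (verbatim):
«continuum YM on T⁴ ⇐ BetaPertH ∧ nine spine estimates (0/9 proved); BetaPertH ⇐ (D1) ∧ (D4) ∧ CAP+tail; G-an2-4 gates asym, D1 and
NE2/3/4.»  [folklore] bookkeeping estimates; NO cited fact, NO `def … : Prop` hypothesis, NO wall binder, NO new object.  NOT summit
progress; nothing of (CONV-C)'s K-slot is discharged here.

## What is proved (general `D`, `N ≥ 1`; complex `p` with `hre : ∀ i, |(p i).re| ≤ π`, `him : ∀ i, |(p i).im| ≤ η`, `0 ≤ η ≤ 1`;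
## a NONZERO alias `m`; `L := lapR (kfine N (reVec p) m)` its REAL Laplacian symbol; SMALLNESS `hsm : (3D/2 + 2)·η ≤ 1/2`, i.e. ONE
## `N`-free number `η ≤ 1/(3D + 4)` — `1/16` at `D = 4`)
From part 1 `StripAliasBounds.norm_LAl_sub_lapR_le_mul` (`‖L_m(p) − L‖ ≤ (3D/2 + 2)·η·L`) and `4 ≤ N²·L` (leaf P1-L06):
* §1 `lapR_pos_of_ne_zero` (`0 < L`), `norm_LAl_sub_lapR_le_half` (`≤ L/2`), **`half_lapR_le_norm_LAl`** (`L/2 ≤ ‖L_m(p)‖`),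
  `norm_LAl_le` (`≤ 3L/2`), **`half_lapR_le_re_LAl`** (`L/2 ≤ re L_m(p)` — the good blocks stay ACCRETIVE), `abs_im_LAl_le` (`≤ L/2`),
  **`LAl_ne_zero_of_strip`**, **`mem_reg_of_strip`** (`m ∈ AliasObjects.reg N p`), `two_div_sq_le_norm_LAl` (`2/N² ≤ ‖L_m(p)‖`),
  `norm_inv_LAl_le` (`‖L_m(p)⁻¹‖ ≤ 2/L`), `norm_LAl_ofRealVec_le_two_mul` / `norm_LAl_le_three_mul_norm` (the two complex symbols at `p` and
  at `Re p` are comparable: `‖L_m(Re p)‖ ≤ 2‖L_m(p)‖`, `‖L_m(p)‖ ≤ (3/2)‖L_m(Re p)‖`).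
* §2 BLOCK SIZES at complex `p` against `‖L_m(p)‖` (so `FibreBlockSolve.Asol/musol` + `FibreBlockBounds` apply to the good blocks at complex
  `p` with the REAL-zone orders): `norm_dAl_sq_le` / `norm_dbAl_sq_le` (`‖∂_{mκ}(p)‖² ≤ 4L`), `norm_dAl_mul_norm_dbAl_le` (`‖∂_{mκ}‖·‖∂♭_{ml}‖ ≤ 4L ≤ 8‖L_m(p)‖`),
  `sum_norm_dAl_sq_le` / `sum_norm_dbAl_sq_le` (`Σ_κ ‖∂_{mκ}(p)‖² ≤ 4L ≤ 8‖L_m(p)‖`), and the `sqrt` forms `norm_dAl_le_two_sqrt` /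
  `norm_dbAl_le_two_sqrt` (`≤ 2√L`).
Unit `b2b-balaban-gan24-formalise-leaf-18` (G-an2-4 formalisation swarm), 2026-08-20.
-/

noncomputable section

open Complex Finset
open scoped BigOperators Real
open Literature.Probability.LatticeModels (TorusSite)
open Literature.MathematicalPhysics.QuantumFieldTheory
open Literature.MathematicalPhysics.QuantumFieldTheory.Balaban1983to89
open B4Strip (ofRealVec reVec)
open Summit.QuantumFields.BalabanUV.Beta.GAN24.AliasWeights (kfine)
open Summit.QuantumFields.BalabanUV.Beta.GAN24.AliasWeightsSum (lapR lapR_nonneg)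
open Summit.QuantumFields.BalabanUV.Beta.GAN24.AliasObjects (dAl dbAl LAl reg mem_reg)
open Summit.QuantumFields.BalabanUV.Beta.GAN24.StripAliasBounds (norm_LAl_sub_lapR_le_mul four_le_sq_mul_lapR_re sq_div_le_lapR
  norm_dAl_le norm_dbAl_le sum_sin_sq_eq_lapR_div)
open Summit.QuantumFields.BalabanUV.Beta.GAN24.CapacitanceScalarDictionary (LAl_ofRealVec)

namespace Summit.QuantumFields.BalabanUV.Beta.GAN24.StripAliasGoodBlocks

variable {D : ℕ} {N : ℕ} [NeZero N] {p : Fin D → ℂ} {η : ℝ} {m : TorusSite D N}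

/-! ## §1 Non-vanishing, accretivity and two-sided comparison of `L_m(p)` with `L = lapR(x_m)` -/

/-- [folklore] A nonzero alias has a POSITIVE real Laplacian symbol (`4 ≤ N²·L`). -/
theorem lapR_pos_of_ne_zero (hre : ∀ i, |(p i).re| ≤ π) (hm : m ≠ 0) : 0 < lapR (kfine N (reVec p) m) := by
  have h4 := four_le_sq_mul_lapR_re hre hm
  exact pos_of_mul_pos_right (by linarith) (sq_nonneg (N : ℝ))

/-- [folklore] Under the smallness `(3D/2 + 2)·η ≤ 1/2`: `‖L_m(p) − L‖ ≤ L/2`. -/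
theorem norm_LAl_sub_lapR_le_half (hre : ∀ i, |(p i).re| ≤ π) (him : ∀ i, |(p i).im| ≤ η) (hη : 0 ≤ η) (hη1 : η ≤ 1)
    (hsm : (3 * D / 2 + 2) * η ≤ 1 / 2) (hm : m ≠ 0) :
    ‖LAl N p m - ((lapR (kfine N (reVec p) m) : ℝ) : ℂ)‖ ≤ lapR (kfine N (reVec p) m) / 2 := by
  have h := norm_LAl_sub_lapR_le_mul hre him hη hη1 hm
  have hL0 : 0 ≤ lapR (kfine N (reVec p) m) := lapR_nonneg _
  calc ‖LAl N p m - ((lapR (kfine N (reVec p) m) : ℝ) : ℂ)‖ ≤ (3 * D / 2 + 2) * η * lapR (kfine N (reVec p) m) := h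
    _ ≤ (1 / 2) * lapR (kfine N (reVec p) m) := mul_le_mul_of_nonneg_right hsm hL0
    _ = lapR (kfine N (reVec p) m) / 2 := by ring

/-- [folklore] **LOWER BOUND**: `L/2 ≤ ‖L_m(p)‖` on the strip for a good alias. -/
theorem half_lapR_le_norm_LAl (hre : ∀ i, |(p i).re| ≤ π) (him : ∀ i, |(p i).im| ≤ η) (hη : 0 ≤ η) (hη1 : η ≤ 1)
    (hsm : (3 * D / 2 + 2) * η ≤ 1 / 2) (hm : m ≠ 0) :
    lapR (kfine N (reVec p) m) / 2 ≤ ‖LAl N p m‖ := by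
  have h := norm_LAl_sub_lapR_le_half hre him hη hη1 hsm hm
  have hL0 : 0 ≤ lapR (kfine N (reVec p) m) := lapR_nonneg _
  have hnL : ‖((lapR (kfine N (reVec p) m) : ℝ) : ℂ)‖ = lapR (kfine N (reVec p) m) := by
    rw [Complex.norm_real, Real.norm_eq_abs, abs_of_nonneg hL0]
  have htri : ‖((lapR (kfine N (reVec p) m) : ℝ) : ℂ)‖ ≤ ‖LAl N p m‖ + ‖LAl N p m - ((lapR (kfine N (reVec p) m) : ℝ) : ℂ)‖ := by
    calc ‖((lapR (kfine N (reVec p) m) : ℝ) : ℂ)‖ = ‖LAl N p m - (LAl N p m - ((lapR (kfine N (reVec p) m) : ℝ) : ℂ))‖ := by ring_nf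
      _ ≤ ‖LAl N p m‖ + ‖LAl N p m - ((lapR (kfine N (reVec p) m) : ℝ) : ℂ)‖ := norm_sub_le _ _
  rw [hnL] at htri
  linarith

/-- [folklore] **UPPER BOUND**: `‖L_m(p)‖ ≤ 3L/2`. -/
theorem norm_LAl_le (hre : ∀ i, |(p i).re| ≤ π) (him : ∀ i, |(p i).im| ≤ η) (hη : 0 ≤ η) (hη1 : η ≤ 1)
    (hsm : (3 * D / 2 + 2) * η ≤ 1 / 2) (hm : m ≠ 0) :
    ‖LAl N p m‖ ≤ 3 * lapR (kfine N (reVec p) m) / 2 := by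
  have h := norm_LAl_sub_lapR_le_half hre him hη hη1 hsm hm
  have hL0 : 0 ≤ lapR (kfine N (reVec p) m) := lapR_nonneg _
  have hnL : ‖((lapR (kfine N (reVec p) m) : ℝ) : ℂ)‖ = lapR (kfine N (reVec p) m) := by
    rw [Complex.norm_real, Real.norm_eq_abs, abs_of_nonneg hL0]
  calc ‖LAl N p m‖ = ‖(LAl N p m - ((lapR (kfine N (reVec p) m) : ℝ) : ℂ)) + ((lapR (kfine N (reVec p) m) : ℝ) : ℂ)‖ := by ring_nf
    _ ≤ ‖LAl N p m - ((lapR (kfine N (reVec p) m) : ℝ) : ℂ)‖ + ‖((lapR (kfine N (reVec p) m) : ℝ) : ℂ)‖ := norm_add_le _ _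
    _ ≤ 3 * lapR (kfine N (reVec p) m) / 2 := by rw [hnL]; linarith

/-- [folklore] **ACCRETIVITY**: `L/2 ≤ re L_m(p)` — the good blocks keep a positive real part on the strip. -/
theorem half_lapR_le_re_LAl (hre : ∀ i, |(p i).re| ≤ π) (him : ∀ i, |(p i).im| ≤ η) (hη : 0 ≤ η) (hη1 : η ≤ 1)
    (hsm : (3 * D / 2 + 2) * η ≤ 1 / 2) (hm : m ≠ 0) :
    lapR (kfine N (reVec p) m) / 2 ≤ (LAl N p m).re := by
  have h := norm_LAl_sub_lapR_le_half hre him hη hη1 hsm hm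
  have hre' : |(LAl N p m - ((lapR (kfine N (reVec p) m) : ℝ) : ℂ)).re| ≤ lapR (kfine N (reVec p) m) / 2 :=
    (Complex.abs_re_le_norm _).trans h
  rw [Complex.sub_re, Complex.ofReal_re] at hre'
  have := neg_abs_le ((LAl N p m).re - lapR (kfine N (reVec p) m))
  linarith

/-- [folklore] `|im L_m(p)| ≤ L/2`. -/
theorem abs_im_LAl_le (hre : ∀ i, |(p i).re| ≤ π) (him : ∀ i, |(p i).im| ≤ η) (hη : 0 ≤ η) (hη1 : η ≤ 1)
    (hsm : (3 * D / 2 + 2) * η ≤ 1 / 2) (hm : m ≠ 0) :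
    |(LAl N p m).im| ≤ lapR (kfine N (reVec p) m) / 2 := by
  have h := norm_LAl_sub_lapR_le_half hre him hη hη1 hsm hm
  have him' : |(LAl N p m - ((lapR (kfine N (reVec p) m) : ℝ) : ℂ)).im| ≤ lapR (kfine N (reVec p) m) / 2 :=
    (Complex.abs_im_le_norm _).trans h
  rwa [Complex.sub_im, Complex.ofReal_im, sub_zero] at him'

/-- [folklore] **THE GOOD ALIASES STAY REGULAR ON THE STRIP**: `L_m(p) ≠ 0` for `m ≠ 0`, `|Re p_i| ≤ π`, `|Im p_i| ≤ η`, `(3D/2 + 2)η ≤ 1/2`. -/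
theorem LAl_ne_zero_of_strip (hre : ∀ i, |(p i).re| ≤ π) (him : ∀ i, |(p i).im| ≤ η) (hη : 0 ≤ η) (hη1 : η ≤ 1)
    (hsm : (3 * D / 2 + 2) * η ≤ 1 / 2) (hm : m ≠ 0) : LAl N p m ≠ 0 := by
  intro h0
  have h := half_lapR_le_norm_LAl hre him hη hη1 hsm hm
  rw [h0, norm_zero] at h
  have hpos := lapR_pos_of_ne_zero (N := N) hre hm
  linarith

/-- [folklore] Hence every nonzero alias is in the regular set `AliasObjects.reg N p` on the strip. -/
theorem mem_reg_of_strip (hre : ∀ i, |(p i).re| ≤ π) (him : ∀ i, |(p i).im| ≤ η) (hη : 0 ≤ η) (hη1 : η ≤ 1)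
    (hsm : (3 * D / 2 + 2) * η ≤ 1 / 2) (hm : m ≠ 0) : m ∈ reg N p :=
  (mem_reg N p m).2 (LAl_ne_zero_of_strip hre him hη hη1 hsm hm)

/-- [folklore] `N`-SCALED LOWER BOUND: `2/N² ≤ ‖L_m(p)‖` for a good alias on the strip. -/
theorem two_div_sq_le_norm_LAl (hre : ∀ i, |(p i).re| ≤ π) (him : ∀ i, |(p i).im| ≤ η) (hη : 0 ≤ η) (hη1 : η ≤ 1)
    (hsm : (3 * D / 2 + 2) * η ≤ 1 / 2) (hm : m ≠ 0) : 2 / (N : ℝ) ^ 2 ≤ ‖LAl N p m‖ := by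
  have h := half_lapR_le_norm_LAl hre him hη hη1 hsm hm
  have h4 := four_le_sq_mul_lapR_re hre hm
  have hN : (0 : ℝ) < N := by exact_mod_cast Nat.pos_of_ne_zero (NeZero.ne N)
  rw [div_le_iff₀ (by positivity)]
  nlinarith

/-- [folklore] INVERSE BOUND: `‖L_m(p)⁻¹‖ ≤ 2/L`. -/
theorem norm_inv_LAl_le (hre : ∀ i, |(p i).re| ≤ π) (him : ∀ i, |(p i).im| ≤ η) (hη : 0 ≤ η) (hη1 : η ≤ 1)
    (hsm : (3 * D / 2 + 2) * η ≤ 1 / 2) (hm : m ≠ 0) : ‖(LAl N p m)⁻¹‖ ≤ 2 / lapR (kfine N (reVec p) m) := by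
  have h := half_lapR_le_norm_LAl hre him hη hη1 hsm hm
  have hpos := lapR_pos_of_ne_zero (N := N) hre hm
  rw [norm_inv]
  calc ‖LAl N p m‖⁻¹ ≤ (lapR (kfine N (reVec p) m) / 2)⁻¹ := inv_anti₀ (by positivity) h
    _ = 2 / lapR (kfine N (reVec p) m) := by rw [inv_div]

/-- [folklore] COMPARISON of the two complex symbols: `‖L_m(Re p)‖ ≤ 2‖L_m(p)‖`. -/
theorem norm_LAl_ofRealVec_le_two_mul (hre : ∀ i, |(p i).re| ≤ π) (him : ∀ i, |(p i).im| ≤ η) (hη : 0 ≤ η) (hη1 : η ≤ 1)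
    (hsm : (3 * D / 2 + 2) * η ≤ 1 / 2) (hm : m ≠ 0) : ‖LAl N (ofRealVec (reVec p)) m‖ ≤ 2 * ‖LAl N p m‖ := by
  have h := half_lapR_le_norm_LAl hre him hη hη1 hsm hm
  rw [LAl_ofRealVec, Complex.norm_real, Real.norm_eq_abs, abs_of_nonneg (lapR_nonneg _)]
  linarith

/-- [folklore] COMPARISON of the two complex symbols: `‖L_m(p)‖ ≤ (3/2)‖L_m(Re p)‖`. -/
theorem norm_LAl_le_three_halves_mul (hre : ∀ i, |(p i).re| ≤ π) (him : ∀ i, |(p i).im| ≤ η) (hη : 0 ≤ η) (hη1 : η ≤ 1)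
    (hsm : (3 * D / 2 + 2) * η ≤ 1 / 2) (hm : m ≠ 0) : ‖LAl N p m‖ ≤ 3 / 2 * ‖LAl N (ofRealVec (reVec p)) m‖ := by
  have h := norm_LAl_le hre him hη hη1 hsm hm
  rw [LAl_ofRealVec, Complex.norm_real, Real.norm_eq_abs, abs_of_nonneg (lapR_nonneg _)]
  linarith

/-! ## §2 Block sizes at complex `p` against `L` and `‖L_m(p)‖` -/

/-- [folklore] From `(3D/2 + 2)·η ≤ 1/2`: `η ≤ 1/4` and `D·η ≤ 1/3`. -/
theorem eta_le_of_small (hη : 0 ≤ η) (hsm : (3 * D / 2 + 2) * η ≤ 1 / 2) : η ≤ 1 / 4 ∧ (D : ℝ) * η ≤ 1 / 3 := by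
  have hD : (0 : ℝ) ≤ D := Nat.cast_nonneg D
  constructor <;> nlinarith

/-- [folklore] `4 sin²(x_κ/2) ≤ L` (one term of the sum). -/
theorem four_sin_sq_le_lapR (x : Fin D → ℝ) (κ : Fin D) : 4 * Real.sin (x κ / 2) ^ 2 ≤ lapR x :=
  Finset.single_le_sum (f := fun i => 4 * Real.sin (x i / 2) ^ 2) (fun i _ => by positivity) (Finset.mem_univ κ)

/-- [folklore] Squared bound of a strip symbol from `‖·‖ ≤ 2|sin(x_κ/2)| + 2η/N`: `≤ 2·(4 sin²) + 8(η/N)² ≤ 2L·(…)` — here the raw form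
`(2|s| + 2e)² ≤ 8 s² + 8 e²`. -/
theorem sq_le_of_le_add {a s e : ℝ} (ha : 0 ≤ a) (h : a ≤ 2 * s + 2 * e) : a ^ 2 ≤ 8 * s ^ 2 + 8 * e ^ 2 := by
  nlinarith [sq_nonneg (s - e), mul_le_mul h h ha (by linarith)]

/-- [folklore] **`‖∂_{mκ}(p)‖² ≤ 4L`** for a good alias on the strip (`(2|sin| + 2η/N)² ≤ 2·4sin² + 8(η/N)² ≤ 2L + 2η²L ≤ 4L`). -/
theorem norm_dAl_sq_le (hre : ∀ i, |(p i).re| ≤ π) (him : ∀ i, |(p i).im| ≤ η) (hη : 0 ≤ η) (hη1 : η ≤ 1) (hm : m ≠ 0)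
    (κ : Fin D) : ‖dAl N p m κ‖ ^ 2 ≤ 4 * lapR (kfine N (reVec p) m) := by
  have hN : (0 : ℝ) < N := by exact_mod_cast Nat.pos_of_ne_zero (NeZero.ne N)
  have h := norm_dAl_le him hη1 m κ
  have hsq := sq_le_of_le_add (norm_nonneg _) h
  rw [sq_abs] at hsq
  have h1 := four_sin_sq_le_lapR (kfine N (reVec p) m) κ
  have h2 := sq_div_le_lapR hre hm η
  have hL0 := lapR_nonneg (kfine N (reVec p) m)
  have h3 : η ^ 2 * lapR (kfine N (reVec p) m) ≤ lapR (kfine N (reVec p) m) := by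
    have : η ^ 2 ≤ 1 := by nlinarith
    nlinarith
  nlinarith

/-- [folklore] **`‖∂♭_{mκ}(p)‖² ≤ 4L`**. -/
theorem norm_dbAl_sq_le (hre : ∀ i, |(p i).re| ≤ π) (him : ∀ i, |(p i).im| ≤ η) (hη : 0 ≤ η) (hη1 : η ≤ 1) (hm : m ≠ 0)
    (κ : Fin D) : ‖dbAl N p m κ‖ ^ 2 ≤ 4 * lapR (kfine N (reVec p) m) := by
  have hN : (0 : ℝ) < N := by exact_mod_cast Nat.pos_of_ne_zero (NeZero.ne N)
  have h := norm_dbAl_le him hη1 m κ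
  have hsq := sq_le_of_le_add (norm_nonneg _) h
  rw [sq_abs] at hsq
  have h1 := four_sin_sq_le_lapR (kfine N (reVec p) m) κ
  have h2 := sq_div_le_lapR hre hm η
  have hL0 := lapR_nonneg (kfine N (reVec p) m)
  have h3 : η ^ 2 * lapR (kfine N (reVec p) m) ≤ lapR (kfine N (reVec p) m) := by
    have : η ^ 2 ≤ 1 := by nlinarith
    nlinarith
  nlinarith

/-- [folklore] `a² ≤ 4L` ⇒ `a ≤ 2√L`. -/
theorem le_two_sqrt_of_sq_le {a L : ℝ} (hL : 0 ≤ L) (h : a ^ 2 ≤ 4 * L) : a ≤ 2 * Real.sqrt L := by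
  have h2 : (2 * Real.sqrt L) ^ 2 = 4 * L := by rw [mul_pow, Real.sq_sqrt hL]; ring
  have h0 : 0 ≤ 2 * Real.sqrt L := by positivity
  nlinarith [sq_nonneg (a - 2 * Real.sqrt L), sq_nonneg (a + 2 * Real.sqrt L)]

/-- [folklore] `‖∂_{mκ}(p)‖ ≤ 2√L`. -/
theorem norm_dAl_le_two_sqrt (hre : ∀ i, |(p i).re| ≤ π) (him : ∀ i, |(p i).im| ≤ η) (hη : 0 ≤ η) (hη1 : η ≤ 1) (hm : m ≠ 0)
    (κ : Fin D) : ‖dAl N p m κ‖ ≤ 2 * Real.sqrt (lapR (kfine N (reVec p) m)) :=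
  le_two_sqrt_of_sq_le (lapR_nonneg _) (norm_dAl_sq_le hre him hη hη1 hm κ)

/-- [folklore] `‖∂♭_{mκ}(p)‖ ≤ 2√L`. -/
theorem norm_dbAl_le_two_sqrt (hre : ∀ i, |(p i).re| ≤ π) (him : ∀ i, |(p i).im| ≤ η) (hη : 0 ≤ η) (hη1 : η ≤ 1) (hm : m ≠ 0)
    (κ : Fin D) : ‖dbAl N p m κ‖ ≤ 2 * Real.sqrt (lapR (kfine N (reVec p) m)) :=
  le_two_sqrt_of_sq_le (lapR_nonneg _) (norm_dbAl_sq_le hre him hη hη1 hm κ)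

/-- [folklore] **PRODUCT OF BLOCK SIZES**: `‖∂_{mκ}(p)‖·‖∂♭_{ml}(p)‖ ≤ 4L` (AM–GM of the two squared bounds). -/
theorem norm_dAl_mul_norm_dbAl_le (hre : ∀ i, |(p i).re| ≤ π) (him : ∀ i, |(p i).im| ≤ η) (hη : 0 ≤ η) (hη1 : η ≤ 1) (hm : m ≠ 0)
    (κ l : Fin D) : ‖dAl N p m κ‖ * ‖dbAl N p m l‖ ≤ 4 * lapR (kfine N (reVec p) m) := by
  have h1 := norm_dAl_sq_le hre him hη hη1 hm κ
  have h2 := norm_dbAl_sq_le hre him hη hη1 hm l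
  nlinarith [sq_nonneg (‖dAl N p m κ‖ - ‖dbAl N p m l‖), norm_nonneg (dAl N p m κ), norm_nonneg (dbAl N p m l)]

/-- [folklore] The same against the complex symbol: `‖∂_{mκ}(p)‖·‖∂♭_{ml}(p)‖ ≤ 8‖L_m(p)‖` (needs the smallness of §1). -/
theorem norm_dAl_mul_norm_dbAl_le_norm_LAl (hre : ∀ i, |(p i).re| ≤ π) (him : ∀ i, |(p i).im| ≤ η) (hη : 0 ≤ η) (hη1 : η ≤ 1)
    (hsm : (3 * D / 2 + 2) * η ≤ 1 / 2) (hm : m ≠ 0) (κ l : Fin D) : ‖dAl N p m κ‖ * ‖dbAl N p m l‖ ≤ 8 * ‖LAl N p m‖ := by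
  have h := norm_dAl_mul_norm_dbAl_le hre him hη hη1 hm κ l
  have h' := half_lapR_le_norm_LAl hre him hη hη1 hsm hm
  linarith

/-- [folklore] `‖∂_{mκ}(p)‖² ≤ 8‖L_m(p)‖`. -/
theorem norm_dAl_sq_le_norm_LAl (hre : ∀ i, |(p i).re| ≤ π) (him : ∀ i, |(p i).im| ≤ η) (hη : 0 ≤ η) (hη1 : η ≤ 1)
    (hsm : (3 * D / 2 + 2) * η ≤ 1 / 2) (hm : m ≠ 0) (κ : Fin D) : ‖dAl N p m κ‖ ^ 2 ≤ 8 * ‖LAl N p m‖ := by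
  have h := norm_dAl_sq_le hre him hη hη1 hm κ
  have h' := half_lapR_le_norm_LAl hre him hη hη1 hsm hm
  linarith

/-- [folklore] `‖∂♭_{mκ}(p)‖² ≤ 8‖L_m(p)‖`. -/
theorem norm_dbAl_sq_le_norm_LAl (hre : ∀ i, |(p i).re| ≤ π) (him : ∀ i, |(p i).im| ≤ η) (hη : 0 ≤ η) (hη1 : η ≤ 1)
    (hsm : (3 * D / 2 + 2) * η ≤ 1 / 2) (hm : m ≠ 0) (κ : Fin D) : ‖dbAl N p m κ‖ ^ 2 ≤ 8 * ‖LAl N p m‖ := by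
  have h := norm_dbAl_sq_le hre him hη hη1 hm κ
  have h' := half_lapR_le_norm_LAl hre him hη hη1 hsm hm
  linarith

/-- [folklore] **SUM OF SQUARED BLOCK SIZES**: `Σ_κ ‖∂_{mκ}(p)‖² ≤ 4L` (`Σ_κ (2|sin| + 2η/N)² ≤ 2L + 8D(η/N)² ≤ 2L + 2Dη²L`, `Dη² ≤ 1`). -/
theorem sum_norm_dAl_sq_le (hre : ∀ i, |(p i).re| ≤ π) (him : ∀ i, |(p i).im| ≤ η) (hη : 0 ≤ η) (hη1 : η ≤ 1)
    (hsm : (3 * D / 2 + 2) * η ≤ 1 / 2) (hm : m ≠ 0) : ∑ κ, ‖dAl N p m κ‖ ^ 2 ≤ 4 * lapR (kfine N (reVec p) m) := by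
  have hN : (0 : ℝ) < N := by exact_mod_cast Nat.pos_of_ne_zero (NeZero.ne N)
  set L := lapR (kfine N (reVec p) m) with hL
  have hL0 : 0 ≤ L := lapR_nonneg _
  have hk : ∀ κ : Fin D, ‖dAl N p m κ‖ ^ 2 ≤ 8 * Real.sin (kfine N (reVec p) m κ / 2) ^ 2 + 8 * (η / N) ^ 2 := by
    intro κ
    have h := norm_dAl_le him hη1 m κ
    have hsq := sq_le_of_le_add (norm_nonneg _) h
    rwa [sq_abs] at hsq
  have hs := Finset.sum_le_sum fun κ (_ : κ ∈ Finset.univ) => hk κ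
  rw [Finset.sum_add_distrib, ← Finset.mul_sum, sum_sin_sq_eq_lapR_div, Finset.sum_const, Finset.card_univ, Fintype.card_fin,
    nsmul_eq_mul] at hs
  have h2 := sq_div_le_lapR hre hm η
  have hDη := (eta_le_of_small (D := D) hη hsm).2
  have hD : (0 : ℝ) ≤ D := Nat.cast_nonneg D
  -- `8D(η/N)² ≤ 2Dη²L ≤ 2L` since `Dη ≤ 1/3`, `η ≤ 1`
  have h3 : (D : ℝ) * (8 * (η / N) ^ 2) ≤ 2 * L := by
    have h4 : (D : ℝ) * (8 * (η / N) ^ 2) ≤ 2 * ((D : ℝ) * η) * η * L := by nlinarith [mul_le_mul_of_nonneg_left h2 hD]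
    have h5 : 2 * ((D : ℝ) * η) * η * L ≤ 2 * L := by
      have : (D : ℝ) * η * η ≤ 1 := by nlinarith [mul_nonneg hD hη]
      nlinarith
    linarith
  linarith

/-- [folklore] `Σ_κ ‖∂♭_{mκ}(p)‖² ≤ 4L`. -/
theorem sum_norm_dbAl_sq_le (hre : ∀ i, |(p i).re| ≤ π) (him : ∀ i, |(p i).im| ≤ η) (hη : 0 ≤ η) (hη1 : η ≤ 1)
    (hsm : (3 * D / 2 + 2) * η ≤ 1 / 2) (hm : m ≠ 0) : ∑ κ, ‖dbAl N p m κ‖ ^ 2 ≤ 4 * lapR (kfine N (reVec p) m) := by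
  have hN : (0 : ℝ) < N := by exact_mod_cast Nat.pos_of_ne_zero (NeZero.ne N)
  set L := lapR (kfine N (reVec p) m) with hL
  have hL0 : 0 ≤ L := lapR_nonneg _
  have hk : ∀ κ : Fin D, ‖dbAl N p m κ‖ ^ 2 ≤ 8 * Real.sin (kfine N (reVec p) m κ / 2) ^ 2 + 8 * (η / N) ^ 2 := by
    intro κ
    have h := norm_dbAl_le him hη1 m κ
    have hsq := sq_le_of_le_add (norm_nonneg _) h
    rwa [sq_abs] at hsq
  have hs := Finset.sum_le_sum fun κ (_ : κ ∈ Finset.univ) => hk κ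
  rw [Finset.sum_add_distrib, ← Finset.mul_sum, sum_sin_sq_eq_lapR_div, Finset.sum_const, Finset.card_univ, Fintype.card_fin,
    nsmul_eq_mul] at hs
  have h2 := sq_div_le_lapR hre hm η
  have hDη := (eta_le_of_small (D := D) hη hsm).2
  have hD : (0 : ℝ) ≤ D := Nat.cast_nonneg D
  have h3 : (D : ℝ) * (8 * (η / N) ^ 2) ≤ 2 * L := by
    have h4 : (D : ℝ) * (8 * (η / N) ^ 2) ≤ 2 * ((D : ℝ) * η) * η * L := by nlinarith [mul_le_mul_of_nonneg_left h2 hD]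
    have h5 : 2 * ((D : ℝ) * η) * η * L ≤ 2 * L := by
      have : (D : ℝ) * η * η ≤ 1 := by nlinarith [mul_nonneg hD hη]
      nlinarith
    linarith
  linarith

/-- [folklore] `Σ_κ ‖∂_{mκ}(p)‖² ≤ 8‖L_m(p)‖` and `Σ_κ ‖∂♭_{mκ}(p)‖² ≤ 8‖L_m(p)‖`. -/
theorem sum_norm_dAl_sq_le_norm_LAl (hre : ∀ i, |(p i).re| ≤ π) (him : ∀ i, |(p i).im| ≤ η) (hη : 0 ≤ η) (hη1 : η ≤ 1)
    (hsm : (3 * D / 2 + 2) * η ≤ 1 / 2) (hm : m ≠ 0) :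
    ∑ κ, ‖dAl N p m κ‖ ^ 2 ≤ 8 * ‖LAl N p m‖ ∧ ∑ κ, ‖dbAl N p m κ‖ ^ 2 ≤ 8 * ‖LAl N p m‖ := by
  have h' := half_lapR_le_norm_LAl hre him hη hη1 hsm hm
  exact ⟨(sum_norm_dAl_sq_le hre him hη hη1 hsm hm).trans (by linarith),
    (sum_norm_dbAl_sq_le hre him hη hη1 hsm hm).trans (by linarith)⟩

end Summit.QuantumFields.BalabanUV.Beta.GAN24.StripAliasGoodBlocks

end
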